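import Mathlib
import Literature.Algebra.Polynomial.GramMatrixMethod
import HarnessLib

/-!
# Scheiderer's ternary quartic: a sum of squares over `ℝ` that is not a sum of squares over `ℚ`

[cite: Scheiderer2012RationalSOS, Thm. 2.1, Lemmas 2.2–2.6, Example 2.8, Remark 2.9, Cor. 2.11];
context [cite: Hillar2009TotallyRealSOS, Thm. 1.3, Conj. 1.4].

Sturmfels asked whether every polynomial with rational coefficients that is a sum of squares
of real polynomials is already a sum of squares of polynomials with *rational* coefficients.
Hillar proved this for sums of squares over totally real number fields
[cite: Hillar2009TotallyRealSOS, Thm. 1.3]; Scheiderer answered the general question in the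
negative [cite: Scheiderer2012RationalSOS, Thm. 2.1] with the explicit ternary quartic
[cite: Scheiderer2012RationalSOS, Example 2.8]

  `f = x⁴ + x y³ + y⁴ − 3 x² y z − 4 x y² z + 2 x² z² + x z³ + y z³ + z⁴`,

the norm form `N_{K/ℚ}(x + α y + α² z)` of the cubic field `K = ℚ(α)`, `α³ = 2α − 2`
(discriminant `−76`).  This file proves, fully and without named facts:

* `four_mul_F_eq` — the two-squares identity behind [Scheiderer2012RationalSOS, Example 2.8]:
  for every `β` with `β³ = 4β + 1` one has `4 f = A_β² − β B_β²` with explicit quadratic forms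
  `A_β, B_β ∈ ℤ[β][x, y, z]` (we clear the `1/β = β² − 4` of loc. cit.);
* `quartic_real_eq_sq_add_sq`, `isSumSq_quartic_real`, `F_nonneg` — taking the negative real
  root `β`, `f` is a sum of two squares in `ℝ[x, y, z]`, hence `IsSumSq` over `ℝ` and
  nonnegative on `ℝ³` [Scheiderer2012RationalSOS, Thm. 2.1 (1)–(2)];
* `F_rootPos`, `F_rootNeg` — the two real zeros `P± = (±s³ + 1, 2 s², ±2 s)`, `s⁶ = 4 s² + 1`
  (i.e. `s² = β₃ ≈ 2.1149`, the positive root), cf. [Scheiderer2012RationalSOS, Example 2.8];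
* `quadCoeff_eq_zero`, `linCoeff_eq_zero` — the descent step of
  [Scheiderer2012RationalSOS, Lemmas 2.3–2.6] made completely explicit for this `f`: a quadratic
  (resp. linear) form with *rational* coefficients vanishing at both `P₊` and `P₋` is zero.  The
  only arithmetic input is that `t³ − 4t − 1` has no rational root (`rat_cubic_ne`), whence
  `1, β, β²` are linearly independent over `ℚ` (`rat_linIndep_of_cubic`);
* `not_sum_sq_quadForms_rat` — `f` is not a nonnegatively weighted sum of squares of quadratic
  forms with rational coefficients; `not_exists_rational_gram` — no real positive semidefinite
  Gram matrix of `f` (w.r.t. the six quadratic monomials) has rational entries, phrased with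
  `Literature.Algebra.Polynomial.GramMatrixMethod.gramPoly`; and the verbatim
  [Scheiderer2012RationalSOS, Thm. 2.1 (3)]: `not_isSumSq_quartic_rat : ¬ IsSumSq (quartic ℚ)`,
  via the degree bound `GramMatrixMethod.exists_sum_mul_self_eq_of_isSumSq_of_totalDegree_le`
  [cite: Laurent2008, §3.3 Lemma 3.8].

Relation to the tree.  `Literature.Algebra.Polynomial.RationalSosCertificate` (Peyrl–Parrilo
rounding/projection) and `Literature.Computation.Certificates.TraceFormBlocks` (Hillar's trace
forms) are the *positive* side of rational SOS certification; the present file is the *negative*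
side: a rational SOS decomposition exists iff a Gram matrix with rational entries exists
[cite: BlekhermanParriloThomas2012, Thm. 3.43], and for this `f` the Gram spectrahedron is
a single point with irrational coordinates [Scheiderer2012RationalSOS, Remark 2.9], so no exact
rational SOS/Gram certificate exists and any exact-arithmetic SOS verifier working over `ℚ` must
fail on `f`, although `f ≥ 0` and `f` is SOS over `ℝ`.  Strict feasibility (an interior Gram
matrix), the standing hypothesis of Peyrl–Parrilo rounding [BlekhermanParriloThomas2012,
Thm. 3.44: "recent work of Scheiderer [108] shows that this assumption (or a similar one) is
required"], is exactly what fails here.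

No `sorry`, no new axioms, no instances, no notation.
-/

noncomputable section

open MvPolynomial Matrix Finset

namespace Literature.Algebra.Polynomial.ScheidererTernaryQuartic

/-! ### §0. The form -/

/-- Scheiderer's ternary quartic `f(x, y, z)` [cite: Scheiderer2012RationalSOS, Example 2.8],
as a polynomial function over an arbitrary commutative ring. -/
def F {R : Type*} [CommRing R] (x y z : R) : R :=
  x ^ 4 + x * y ^ 3 + y ^ 4 - 3 * x ^ 2 * y * z - 4 * x * y ^ 2 * z + 2 * x ^ 2 * z ^ 2
    + x * z ^ 3 + y * z ^ 3 + z ^ 4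

/-- `F` commutes with ring homomorphisms [cite: Scheiderer2012RationalSOS, Example 2.8]. -/
theorem map_F {R S G : Type*} [CommRing R] [CommRing S] [FunLike G R S] [RingHomClass G R S]
    (φ : G) (x y z : R) : φ (F x y z) = F (φ x) (φ y) (φ z) := by
  simp only [F, map_add, map_sub, map_mul, map_pow, map_ofNat]

/-- Homogeneity of degree `4` on the nose [cite: Scheiderer2012RationalSOS, Example 2.8]. -/
theorem F_smul {R : Type*} [CommRing R] (t x y z : R) :
    F (t * x) (t * y) (t * z) = t ^ 4 * F x y z := by
  unfold F; ring

/-- `f(1, 0, 0) = 1` [cite: Scheiderer2012RationalSOS, Example 2.8]. -/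
theorem F_one_zero_zero {R : Type*} [CommRing R] : F (1 : R) 0 0 = 1 := by
  unfold F; ring

/-- Scheiderer's quartic as an element of `R[x₀, x₁, x₂] = MvPolynomial (Fin 3) R`
[cite: Scheiderer2012RationalSOS, Example 2.8]. -/
def quartic (R : Type*) [CommRing R] : MvPolynomial (Fin 3) R := F (X 0) (X 1) (X 2)

/-- Evaluation of `quartic` [cite: Scheiderer2012RationalSOS, Example 2.8]. -/
theorem aeval_quartic {R A : Type*} [CommRing R] [CommRing A] [Algebra R A] (v : Fin 3 → A) :
    aeval v (quartic R) = F (v 0) (v 1) (v 2) := by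
  rw [quartic, map_F]; simp only [aeval_X]

/-- `quartic ℚ ≠ 0` [cite: Scheiderer2012RationalSOS, Example 2.8]. -/
theorem quartic_ne_zero : quartic ℚ ≠ 0 := by
  intro h
  have h1 := congr_arg (aeval ![(1 : ℚ), 0, 0]) h
  rw [aeval_quartic, map_zero] at h1
  simp [F] at h1

/-- `quartic R` is homogeneous of degree `4` [cite: Scheiderer2012RationalSOS, Example 2.8]. -/
theorem isHomogeneous_quartic (R : Type*) [CommRing R] : (quartic R).IsHomogeneous 4 := by
  have hX : ∀ i : Fin 3, (X i : MvPolynomial (Fin 3) R).IsHomogeneous 1 := isHomogeneous_X R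
  have hC : ∀ r : R, (C r : MvPolynomial (Fin 3) R).IsHomogeneous 0 := isHomogeneous_C (Fin 3)
  have h2 : (2 : MvPolynomial (Fin 3) R).IsHomogeneous 0 := by
    simpa only [map_ofNat] using hC 2
  have h3 : (3 : MvPolynomial (Fin 3) R).IsHomogeneous 0 := by
    simpa only [map_ofNat] using hC 3
  have h4 : (4 : MvPolynomial (Fin 3) R).IsHomogeneous 0 := by
    simpa only [map_ofNat] using hC 4
  unfold quartic F
  refine (((((((((hX 0).pow 4).add ((hX 0).mul ((hX 1).pow 3))).add ((hX 1).pow 4)).sub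
    (((h3.mul ((hX 0).pow 2)).mul (hX 1)).mul (hX 2))).sub
    (((h4.mul (hX 0)).mul ((hX 1).pow 2)).mul (hX 2))).add
    ((h2.mul ((hX 0).pow 2)).mul ((hX 2).pow 2))).add ((hX 0).mul ((hX 2).pow 3))).add
    ((hX 1).mul ((hX 2).pow 3))).add ((hX 2).pow 4)

/-- Hence `totalDegree (quartic R) ≤ 4` [cite: Scheiderer2012RationalSOS, Example 2.8]. -/
theorem totalDegree_quartic_le (R : Type*) [CommRing R] : (quartic R).totalDegree ≤ 4 :=
  (isHomogeneous_quartic R).totalDegree_le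

/-! ### §1. Sum of two squares over `ℝ` -/

/-- The quadratic form `A_β` of [cite: Scheiderer2012RationalSOS, Example 2.8]
(with `1/β` rewritten as `β² − 4`). -/
def qA {R : Type*} [CommRing R] (β x y z : R) : R :=
  2 * x ^ 2 + β * y ^ 2 - y * z + (β ^ 2 - 2) * z ^ 2

/-- The quadratic form `B_β` of [cite: Scheiderer2012RationalSOS, Example 2.8]
(with `1/β` rewritten as `β² − 4`). -/
def qB {R : Type*} [CommRing R] (β x y z : R) : R :=
  2 * x * y - (β ^ 2 - 4) * y ^ 2 + 2 * (β ^ 2 - 4) * x * z + β * y * z - z ^ 2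

/-- `A_β`, `B_β` commute with ring homomorphisms [cite: Scheiderer2012RationalSOS, Example 2.8]. -/
theorem map_qA {R S G : Type*} [CommRing R] [CommRing S] [FunLike G R S] [RingHomClass G R S]
    (φ : G) (β x y z : R) : φ (qA β x y z) = qA (φ β) (φ x) (φ y) (φ z) := by
  simp only [qA, map_add, map_sub, map_mul, map_pow, map_ofNat]

/-- See `map_qA` [cite: Scheiderer2012RationalSOS, Example 2.8]. -/
theorem map_qB {R S G : Type*} [CommRing R] [CommRing S] [FunLike G R S] [RingHomClass G R S]
    (φ : G) (β x y z : R) : φ (qB β x y z) = qB (φ β) (φ x) (φ y) (φ z) := by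
  simp only [qB, map_add, map_sub, map_mul, map_pow, map_ofNat]

/-- **The two-squares identity** [cite: Scheiderer2012RationalSOS, Example 2.8]: whenever
`β³ − 4β − 1 = 0` (the three roots are `β₁ ≈ −1.8608`, `β₂ ≈ −0.2541`, `β₃ ≈ 2.1149`),
`4 f = A_β² − β B_β²` identically.  For `β < 0` this exhibits `f` as a sum of two squares. -/
theorem four_mul_F_eq {R : Type*} [CommRing R] (β x y z : R) (hβ : β ^ 3 = 4 * β + 1) :
    4 * F x y z = qA β x y z ^ 2 - β * qB β x y z ^ 2 := by
  unfold F qA qB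
  linear_combination (8 * x ^ 2 * y * z + 4 * x ^ 2 * z ^ 2 * β ^ 2 - 16 * x ^ 2 * z ^ 2
    - 4 * x * y ^ 3 - 4 * x * y ^ 2 * z * β ^ 2 + 16 * x * y ^ 2 * z + 4 * x * y * z ^ 2 * β
    - 4 * x * z ^ 3 + y ^ 4 * β ^ 2 - 4 * y ^ 4 - 2 * y ^ 3 * z * β + y ^ 2 * z ^ 2
    - z ^ 4 * β) * hβ

/-- The cubic `t³ − 4t − 1` has a negative real root (in fact two)
[cite: Scheiderer2012RationalSOS, Example 2.8]. -/
theorem exists_neg_root : ∃ β : ℝ, β ^ 3 = 4 * β + 1 ∧ β < 0 := by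
  have hcont : ContinuousOn (fun t : ℝ => t ^ 3 - 4 * t - 1) (Set.Icc (-1) 0) := by fun_prop
  obtain ⟨c, ⟨_, hc0⟩, hc⟩ := intermediate_value_Icc' (show (-1 : ℝ) ≤ 0 by norm_num) hcont
    (show (0 : ℝ) ∈ Set.Icc ((0 : ℝ) ^ 3 - 4 * 0 - 1) ((-1) ^ 3 - 4 * (-1) - 1) by norm_num)
  refine ⟨c, by simp only at hc; linarith, lt_of_le_of_ne hc0 ?_⟩
  rintro rfl
  norm_num at hc

/-- **[cite: Scheiderer2012RationalSOS, Thm. 2.1 (2), Example 2.8]**: `f` is a sum of two squares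
of quadratic forms in `ℝ[x, y, z]`, namely `f = (A_β/2)² + (√(−β) B_β/2)²` for a negative root
`β` of `t³ − 4t − 1`. -/
theorem quartic_real_eq_sq_add_sq : ∃ β : ℝ, β ^ 3 = 4 * β + 1 ∧ β < 0 ∧
    quartic ℝ = (C (1 / 2 : ℝ) * qA (C β) (X 0) (X 1) (X 2)) ^ 2
      + (C (Real.sqrt (-β) / 2) * qB (C β) (X 0) (X 1) (X 2)) ^ 2 := by
  obtain ⟨β, hβ, hneg⟩ := exists_neg_root
  refine ⟨β, hβ, hneg, ?_⟩
  have hc : Real.sqrt (-β) ^ 2 = -β := Real.sq_sqrt (by linarith)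
  apply MvPolynomial.funext
  intro v
  rw [MvPolynomial.funext_iff.mp rfl v]
  simp only [map_add, map_mul, map_pow, eval_C]
  rw [show (eval v) (quartic ℝ) = F (v 0) (v 1) (v 2) from by
        rw [quartic, map_F]; simp only [eval_X],
    map_qA, map_qB]
  simp only [eval_C, eval_X]
  have h4 := four_mul_F_eq β (v 0) (v 1) (v 2) hβ
  linear_combination (1 / 4 : ℝ) * h4 - (qB β (v 0) (v 1) (v 2) ^ 2 / 4) * hc

/-- **[cite: Scheiderer2012RationalSOS, Thm. 2.1 (2)]**: `f` is a sum of squares in `ℝ[x, y, z]`. -/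
theorem isSumSq_quartic_real : IsSumSq (quartic ℝ) := by
  obtain ⟨β, _, _, h⟩ := quartic_real_eq_sq_add_sq
  rw [h, sq, sq, ← add_zero (_ * _ + _ * _), add_assoc]
  exact IsSumSq.sq_add _ (IsSumSq.sq_add _ IsSumSq.zero)

/-- **[cite: Scheiderer2012RationalSOS, Thm. 2.1 (2)]**: `f ≥ 0` on `ℝ³`. -/
theorem F_nonneg (x y z : ℝ) : 0 ≤ F x y z := by
  obtain ⟨β, hβ, hneg⟩ := exists_neg_root
  have h4 := four_mul_F_eq β x y z hβ
  nlinarith [sq_nonneg (qA β x y z), mul_nonneg (neg_nonneg.2 hneg.le) (sq_nonneg (qB β x y z))]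

/-! ### §2. The two real zeros -/

/-- There is a real `s ≥ 1` with `s⁶ = 4 s² + 1`, i.e. `s² = β₃` is the positive root of
`t³ − 4t − 1` [cite: Scheiderer2012RationalSOS, Example 2.8]. -/
theorem exists_s : ∃ s : ℝ, s ^ 6 = 4 * s ^ 2 + 1 ∧ 1 ≤ s := by
  have hcont : ContinuousOn (fun t : ℝ => t ^ 6 - 4 * t ^ 2 - 1) (Set.Icc 1 2) := by fun_prop
  obtain ⟨c, ⟨hc1, _⟩, hc⟩ := intermediate_value_Icc (show (1 : ℝ) ≤ 2 by norm_num) hcont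
    (show (0 : ℝ) ∈ Set.Icc ((1 : ℝ) ^ 6 - 4 * 1 ^ 2 - 1) (2 ^ 6 - 4 * 2 ^ 2 - 1) by norm_num)
  exact ⟨c, by simp only at hc; linarith, hc1⟩

/-- `f(s³ + 1, 2s², 2s) = (s⁶ − 4s² − 1)²`; in particular `P₊ = (s³ + 1, 2s², 2s)` is a real zero
of `f` when `s⁶ = 4s² + 1` [cite: Scheiderer2012RationalSOS, Example 2.8, Lemma 2.2]. -/
theorem F_rootPos_eq {R : Type*} [CommRing R] (s : R) :
    F (s ^ 3 + 1) (2 * s ^ 2) (2 * s) = (s ^ 6 - 4 * s ^ 2 - 1) ^ 2 := by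
  unfold F; ring

/-- `f(1 − s³, 2s², −2s) = (s⁶ − 4s² − 1)²`; `P₋ = (1 − s³, 2s², −2s)` is the second real zero
[cite: Scheiderer2012RationalSOS, Example 2.8, Lemma 2.2]. -/
theorem F_rootNeg_eq {R : Type*} [CommRing R] (s : R) :
    F (1 - s ^ 3) (2 * s ^ 2) (-(2 * s)) = (s ^ 6 - 4 * s ^ 2 - 1) ^ 2 := by
  unfold F; ring

/-- `f(t P₊) = 0` for all real `t` [cite: Scheiderer2012RationalSOS, Example 2.8]. -/
theorem F_rootPos {s : ℝ} (hs : s ^ 6 = 4 * s ^ 2 + 1) (t : ℝ) :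
    F (t * (s ^ 3 + 1)) (t * (2 * s ^ 2)) (t * (2 * s)) = 0 := by
  rw [F_smul, F_rootPos_eq, show s ^ 6 - 4 * s ^ 2 - 1 = 0 by rw [hs]; ring]; ring

/-- `f(t P₋) = 0` for all real `t` [cite: Scheiderer2012RationalSOS, Example 2.8]. -/
theorem F_rootNeg {s : ℝ} (hs : s ^ 6 = 4 * s ^ 2 + 1) (t : ℝ) :
    F (t * (1 - s ^ 3)) (t * (2 * s ^ 2)) (t * (-(2 * s))) = 0 := by
  rw [F_smul, F_rootNeg_eq, show s ^ 6 - 4 * s ^ 2 - 1 = 0 by rw [hs]; ring]; ring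

/-! ### §3. The arithmetic input: `t³ − 4t − 1` has no rational root -/

/-- `t³ − 4t − 1` has no rational root (rational root test: a root `n/d` in lowest terms has
`d = 1` and `n ∣ 1`) [cite: Scheiderer2012RationalSOS, Example 2.8]. -/
theorem rat_cubic_ne (r : ℚ) : r ^ 3 ≠ 4 * r + 1 := by
  intro h
  set n : ℤ := r.num with hn
  set d : ℕ := r.den with hd
  have hrd : r * d = n := Rat.mul_den_eq_num r
  have hZ : (n : ℚ) ^ 3 = 4 * n * (d : ℚ) ^ 2 + (d : ℚ) ^ 3 := by
    rw [← hrd]; linear_combination (r * ↑d) ^ 0 * (d : ℚ) ^ 3 * h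
  have hZ' : n ^ 3 = 4 * n * (d : ℤ) ^ 2 + (d : ℤ) ^ 3 := by exact_mod_cast hZ
  have hdvd : (d : ℤ) ∣ n ^ 3 := ⟨4 * n * d + (d : ℤ) ^ 2, by rw [hZ']; ring⟩
  have hdvd' : d ∣ n.natAbs ^ 3 := by
    rw [← Int.natAbs_pow]; exact Int.natCast_dvd.mp hdvd
  have hcop : Nat.Coprime d n.natAbs := r.reduced.symm
  have hd1 : d = 1 := Nat.Coprime.eq_one_of_dvd (hcop.pow_right 3) hdvd'
  have hone : n * (n ^ 2 - 4) = 1 := by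
    have : n ^ 3 = 4 * n + 1 := by simpa [hd1] using hZ'
    linear_combination this
  rcases Int.isUnit_iff.mp (isUnit_of_dvd_one ⟨n ^ 2 - 4, hone.symm⟩) with h1 | h1 <;>
    rw [h1] at hone <;> norm_num at hone

/-- If `β³ = 4β + 1` then `1, β, β²` are linearly independent over `ℚ`
[cite: Scheiderer2012RationalSOS, Example 2.8, Lemma 2.3]. -/
theorem rat_linIndep_of_cubic {β : ℝ} (hβ : β ^ 3 = 4 * β + 1) {a b c : ℚ}
    (h : (a : ℝ) + b * β + c * β ^ 2 = 0) : a = 0 ∧ b = 0 ∧ c = 0 := by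
  have hirr : ∀ r : ℚ, (r : ℝ) ≠ β := by
    intro r hr
    apply rat_cubic_ne r
    have : (r : ℝ) ^ 3 = 4 * r + 1 := by rw [hr]; exact hβ
    exact_mod_cast this
  by_cases hc : c = 0
  · subst hc
    by_cases hb : b = 0
    · subst hb
      refine ⟨?_, rfl, rfl⟩
      simpa using h
    · exfalso
      apply hirr (-a / b)
      have hb' : (b : ℝ) ≠ 0 := by exact_mod_cast hb
      push_cast
      rw [div_eq_iff hb']
      push_cast at h
      linear_combination -h
  · exfalso
    have hc' : (c : ℝ) ≠ 0 := by exact_mod_cast hc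
    have e1 : ((4 * c ^ 2 - b ^ 2 + a * c : ℚ) : ℝ) * β = ((a * b - c ^ 2 : ℚ) : ℝ) := by
      push_cast
      linear_combination (-(b : ℝ) + c * β) * h + (-(c : ℝ) ^ 2) * hβ
    by_cases hq : (4 * c ^ 2 - b ^ 2 + a * c : ℚ) = 0
    · have hq2 : (a * b - c ^ 2 : ℚ) = 0 := by
        have : ((a * b - c ^ 2 : ℚ) : ℝ) = 0 := by rw [← e1, hq]; simp
        exact_mod_cast this
      apply rat_cubic_ne (b / c)
      field_simp
      linear_combination (-b) * hq + c * hq2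
    · apply hirr ((a * b - c ^ 2) / (4 * c ^ 2 - b ^ 2 + a * c))
      have hq' : ((4 * c ^ 2 - b ^ 2 + a * c : ℚ) : ℝ) ≠ 0 := by exact_mod_cast hq
      rw [Rat.cast_div, div_eq_iff hq', ← e1, mul_comm]

/-! ### §4. Rational quadratic and linear forms vanishing at `P₊` and `P₋` -/

/-- The general ternary quadratic form with coefficient vector `c`
(monomial order `x², xy, xz, y², yz, z²`) [cite: Scheiderer2012RationalSOS, Lemma 2.3]. -/
def quadForm {K : Type*} [CommRing K] (c : Fin 6 → K) (x y z : K) : K :=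
  c 0 * x ^ 2 + c 1 * (x * y) + c 2 * (x * z) + c 3 * y ^ 2 + c 4 * (y * z) + c 5 * z ^ 2

/-- The general ternary linear form [cite: Scheiderer2012RationalSOS, Lemma 2.3]. -/
def linForm {K : Type*} [CommRing K] (c : Fin 3 → K) (x y z : K) : K :=
  c 0 * x + c 1 * y + c 2 * z

/-- **Descent for quadratic forms** [cite: Scheiderer2012RationalSOS, Lemmas 2.3–2.6, Example 2.8]:
a quadratic form with rational coefficients vanishing at both real zeros `P₊`, `P₋` of `f` is
identically zero.  (The two points have coordinates in the sextic field `ℚ(s)`, `s² = β₃`; the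
even/odd parts in `s` of `q(P±)` give two `ℚ`-linear relations among `1, β₃, β₃²`.) -/
theorem quadCoeff_eq_zero {s : ℝ} (hs : s ^ 6 = 4 * s ^ 2 + 1) (hs1 : 1 ≤ s) (c : Fin 6 → ℚ)
    (hP : quadForm (fun i => (c i : ℝ)) (s ^ 3 + 1) (2 * s ^ 2) (2 * s) = 0)
    (hM : quadForm (fun i => (c i : ℝ)) (1 - s ^ 3) (2 * s ^ 2) (-(2 * s)) = 0) : c = 0 := by
  have hβ : (s ^ 2) ^ 3 = 4 * s ^ 2 + 1 := by rw [← hs]; ring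
  have hs0 : s ≠ 0 := by intro h0; rw [h0] at hs1; norm_num at hs1
  unfold quadForm at hP hM
  simp only at hP hM
  -- even part
  have hE : ((2 * c 0 : ℚ) : ℝ) + ((4 * c 0 + 2 * c 1 + 4 * c 5 : ℚ) : ℝ) * s ^ 2
      + ((2 * c 2 + 4 * c 3 : ℚ) : ℝ) * (s ^ 2) ^ 2 = 0 := by
    push_cast
    linear_combination (1 / 2 : ℝ) * hP + (1 / 2 : ℝ) * hM - (c 0 : ℝ) * hs
  -- odd part
  have hO' : s * (((2 * c 2 : ℚ) : ℝ) + ((2 * c 0 + 4 * c 4 : ℚ) : ℝ) * s ^ 2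
      + ((2 * c 1 : ℚ) : ℝ) * (s ^ 2) ^ 2) = 0 := by
    push_cast
    linear_combination (1 / 2 : ℝ) * hP - (1 / 2 : ℝ) * hM
  have hO := (mul_eq_zero.mp hO').resolve_left hs0
  obtain ⟨e0, e1, e2⟩ := rat_linIndep_of_cubic hβ hE
  obtain ⟨o0, o1, o2⟩ := rat_linIndep_of_cubic hβ hO
  have h0 : c 0 = 0 := by linarith
  have h2 : c 2 = 0 := by linarith
  have h1 : c 1 = 0 := by linarith
  have h3 : c 3 = 0 := by linarith
  have h4 : c 4 = 0 := by linarith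
  have h5 : c 5 = 0 := by linarith
  funext i
  fin_cases i <;> assumption

/-- **Descent for linear forms** [cite: Scheiderer2012RationalSOS, Lemma 2.3, Example 2.8]: a linear
form with rational coefficients vanishing at `P₊` and `P₋` is zero. -/
theorem linCoeff_eq_zero {s : ℝ} (hs : s ^ 6 = 4 * s ^ 2 + 1) (hs1 : 1 ≤ s) (c : Fin 3 → ℚ)
    (hP : linForm (fun i => (c i : ℝ)) (s ^ 3 + 1) (2 * s ^ 2) (2 * s) = 0)
    (hM : linForm (fun i => (c i : ℝ)) (1 - s ^ 3) (2 * s ^ 2) (-(2 * s)) = 0) : c = 0 := by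
  have hβ : (s ^ 2) ^ 3 = 4 * s ^ 2 + 1 := by rw [← hs]; ring
  have hs0 : s ≠ 0 := by intro h0; rw [h0] at hs1; norm_num at hs1
  unfold linForm at hP hM
  simp only at hP hM
  have hE : ((c 0 : ℚ) : ℝ) + ((2 * c 1 : ℚ) : ℝ) * s ^ 2 + ((0 : ℚ) : ℝ) * (s ^ 2) ^ 2 = 0 := by
    push_cast
    linear_combination (1 / 2 : ℝ) * hP + (1 / 2 : ℝ) * hM
  have hO' : s * (((2 * c 2 : ℚ) : ℝ) + ((c 0 : ℚ) : ℝ) * s ^ 2 + ((0 : ℚ) : ℝ) * (s ^ 2) ^ 2)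
      = 0 := by
    push_cast
    linear_combination (1 / 2 : ℝ) * hP - (1 / 2 : ℝ) * hM
  have hO := (mul_eq_zero.mp hO').resolve_left hs0
  obtain ⟨e0, e1, -⟩ := rat_linIndep_of_cubic hβ hE
  obtain ⟨o0, -, -⟩ := rat_linIndep_of_cubic hβ hO
  have h0 : c 0 = 0 := by linarith
  have h1 : c 1 = 0 := by linarith
  have h2 : c 2 = 0 := by linarith
  funext i
  fin_cases i <;> assumption

/-! ### §5. No rational sum-of-squares / Gram certificate -/

/-- The quadratic form with coefficient vector `c` as an element of `ℚ[x₀, x₁, x₂]`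
[cite: Scheiderer2012RationalSOS, Thm. 2.1]. -/
def quadPoly (c : Fin 6 → ℚ) : MvPolynomial (Fin 3) ℚ :=
  quadForm (fun i => C (c i)) (X 0) (X 1) (X 2)

/-- Real evaluation of `quadPoly` [cite: Scheiderer2012RationalSOS, Thm. 2.1]. -/
theorem aeval_quadPoly (c : Fin 6 → ℚ) (v : Fin 3 → ℝ) :
    aeval v (quadPoly c) = quadForm (fun i => (c i : ℝ)) (v 0) (v 1) (v 2) := by
  simp only [quadPoly, quadForm, map_add, map_mul, map_pow, aeval_X, aeval_C, eq_ratCast]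

/-- `quadPoly 0 = 0` [cite: Scheiderer2012RationalSOS, Thm. 2.1]. -/
theorem quadPoly_zero : quadPoly 0 = 0 := by
  simp [quadPoly, quadForm]

/-- **No weighted rational SOS of quadratic forms** [cite: Scheiderer2012RationalSOS, Thm. 2.1 (3),
Example 2.8]: `f` is not of the form `∑ᵢ wᵢ qᵢ²` in `ℚ[x₀, x₁, x₂]` with rational weights
`wᵢ ≥ 0` and quadratic forms `qᵢ` with rational coefficients. -/
theorem not_sum_sq_quadForms_rat : ¬ ∃ (k : ℕ) (w : Fin k → ℚ) (c : Fin k → Fin 6 → ℚ),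
    (∀ i, 0 ≤ w i) ∧ quartic ℚ = ∑ i, C (w i) * quadPoly (c i) ^ 2 := by
  rintro ⟨k, w, c, hw, hid⟩
  obtain ⟨s, hs, hs1⟩ := exists_s
  -- every summand with nonzero weight vanishes at each real zero of `f`
  have key : ∀ v : Fin 3 → ℝ, F (v 0) (v 1) (v 2) = 0 → ∀ i, w i ≠ 0 →
      quadForm (fun j => (c i j : ℝ)) (v 0) (v 1) (v 2) = 0 := by
    intro v hv i hi
    have h := congr_arg (aeval v) hid
    rw [aeval_quartic, hv, map_sum] at h
    simp only [map_mul, map_pow, aeval_C, eq_ratCast, aeval_quadPoly] at h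
    have hterm := (Finset.sum_eq_zero_iff_of_nonneg (fun j _ =>
      mul_nonneg (by exact_mod_cast hw j) (sq_nonneg _))).mp h.symm i (Finset.mem_univ _)
    have hwi : (w i : ℝ) ≠ 0 := by exact_mod_cast hi
    exact pow_eq_zero_iff (two_ne_zero) |>.mp ((mul_eq_zero.mp hterm).resolve_left hwi)
  have hc : ∀ i, w i ≠ 0 → c i = 0 := by
    intro i hi
    refine quadCoeff_eq_zero hs hs1 (c i) ?_ ?_
    · simpa using key ![s ^ 3 + 1, 2 * s ^ 2, 2 * s] (by simpa using F_rootPos hs 1) i hi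
    · simpa using key ![1 - s ^ 3, 2 * s ^ 2, -(2 * s)] (by simpa using F_rootNeg hs 1) i hi
  apply quartic_ne_zero
  rw [hid]
  refine Finset.sum_eq_zero fun i _ => ?_
  by_cases hi : w i = 0
  · simp [hi]
  · rw [hc i hi, quadPoly_zero]; simp

/-- The six quadratic monomials `x₀², x₀x₁, x₀x₂, x₁², x₁x₂, x₂²` (same order as `quadForm`)
[cite: Scheiderer2012RationalSOS, Remark 2.9]. -/
def mono : Fin 6 → MvPolynomial (Fin 3) ℚ :=
  ![X 0 ^ 2, X 0 * X 1, X 0 * X 2, X 1 ^ 2, X 1 * X 2, X 2 ^ 2]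

/-- Their real values at a point [cite: Scheiderer2012RationalSOS, Remark 2.9]. -/
def monoVal (x y z : ℝ) : Fin 6 → ℝ := ![x ^ 2, x * y, x * z, y ^ 2, y * z, z ^ 2]

/-- Evaluation of the vector `mono` [cite: Scheiderer2012RationalSOS, Remark 2.9]. -/
theorem aeval_mono (v : Fin 3 → ℝ) (i : Fin 6) :
    aeval v (mono i) = monoVal (v 0) (v 1) (v 2) i := by
  fin_cases i <;> simp [mono, monoVal]

/-- Evaluation of a Gram form `zᵀ Q z` with rational `Q` at a real point
[cite: Scheiderer2012RationalSOS, Remark 2.9]. -/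
theorem aeval_gramPoly (Q : Matrix (Fin 6) (Fin 6) ℚ) (v : Fin 3 → ℝ) :
    aeval v (GramMatrixMethod.gramPoly Q mono)
      = monoVal (v 0) (v 1) (v 2) ⬝ᵥ (Q.map ((↑) : ℚ → ℝ)) *ᵥ monoVal (v 0) (v 1) (v 2) := by
  simp only [GramMatrixMethod.gramPoly, map_sum, map_mul, aeval_C, eq_ratCast, aeval_mono,
    dotProduct, mulVec, Matrix.map_apply, Finset.mul_sum]
  exact Finset.sum_congr rfl fun i _ => Finset.sum_congr rfl fun j _ => by ring

/-- Row `i` of `Q v` is the quadratic form with coefficient vector `Q i`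
[cite: Scheiderer2012RationalSOS, Remark 2.9]. -/
theorem mulVec_monoVal (Q : Matrix (Fin 6) (Fin 6) ℚ) (x y z : ℝ) (i : Fin 6) :
    ((Q.map ((↑) : ℚ → ℝ)) *ᵥ monoVal x y z) i = quadForm (fun j => (Q i j : ℝ)) x y z := by
  simp [mulVec, dotProduct, monoVal, quadForm, Fin.sum_univ_succ, add_assoc]

/-- **No rational Gram matrix** [cite: Scheiderer2012RationalSOS, Thm. 2.1 (3), Remark 2.9]: there
is no matrix `Q` with rational entries that is positive semidefinite (over `ℝ`) and represents
`f = zᵀ Q z` on the quadratic monomials.  Equivalently, the Gram spectrahedron of `f` has no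
rational point; by loc. cit. it is the single irrational point given by `four_mul_F_eq`. -/
theorem not_exists_rational_gram : ¬ ∃ Q : Matrix (Fin 6) (Fin 6) ℚ,
    (Q.map ((↑) : ℚ → ℝ)).PosSemidef ∧ quartic ℚ = GramMatrixMethod.gramPoly Q mono := by
  rintro ⟨Q, hQ, hid⟩
  obtain ⟨s, hs, hs1⟩ := exists_s
  have key : ∀ v : Fin 3 → ℝ, F (v 0) (v 1) (v 2) = 0 →
      (Q.map ((↑) : ℚ → ℝ)) *ᵥ monoVal (v 0) (v 1) (v 2) = 0 := by
    intro v hv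
    have h := congr_arg (aeval v) hid
    rw [aeval_quartic, hv, aeval_gramPoly] at h
    rw [← hQ.dotProduct_mulVec_zero_iff]
    simpa using h.symm
  have hrow : ∀ i, (fun j => Q i j) = 0 := by
    intro i
    refine quadCoeff_eq_zero hs hs1 (fun j => Q i j) ?_ ?_
    · have := congr_fun (key ![s ^ 3 + 1, 2 * s ^ 2, 2 * s] (by simpa using F_rootPos hs 1)) i
      simpa [mulVec_monoVal] using this
    · have := congr_fun (key ![1 - s ^ 3, 2 * s ^ 2, -(2 * s)]
        (by simpa using F_rootNeg hs 1)) i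
      simpa [mulVec_monoVal] using this
  have hQ0 : Q = 0 := Matrix.ext fun i j => congr_fun (hrow i) j
  apply quartic_ne_zero
  rw [hid, hQ0]
  simp [GramMatrixMethod.gramPoly]

/-! ### §6. [Scheiderer, Thm. 2.1 (3)] verbatim: `quartic ℚ` is not a sum of squares in `ℚ[x₀, x₁, x₂]` -/

/-- Exponent vectors of the ten monomials of degree `≤ 2` in three variables: the six quadratic
ones in the order of `quadForm`, then `x₀, x₁, x₂, 1` [cite: Scheiderer2012RationalSOS, Thm. 2.1]. -/
def expVec : Fin 6 ⊕ Fin 4 → Fin 3 → ℕ :=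
  Sum.elim ![![2, 0, 0], ![1, 1, 0], ![1, 0, 1], ![0, 2, 0], ![0, 1, 1], ![0, 0, 2]]
    ![![1, 0, 0], ![0, 1, 0], ![0, 0, 1], ![0, 0, 0]]

/-- The same exponents as finitely supported functions [cite: Scheiderer2012RationalSOS, Thm. 2.1]. -/
def expLE2 (i : Fin 6 ⊕ Fin 4) : Fin 3 →₀ ℕ := Finsupp.equivFunOnFinite.symm (expVec i)

/-- Pointwise description of `expLE2` [cite: Scheiderer2012RationalSOS, Thm. 2.1]. -/
theorem expLE2_apply (i : Fin 6 ⊕ Fin 4) (k : Fin 3) : expLE2 i k = expVec i k := rfl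

/-- The ten exponents are pairwise distinct [cite: Scheiderer2012RationalSOS, Thm. 2.1]. -/
theorem expLE2_injective : Function.Injective expLE2 :=
  (Equiv.injective _).comp (by decide : Function.Injective expVec)

/-- Every exponent of degree `≤ 2` in three variables is one of the ten
[cite: Scheiderer2012RationalSOS, Thm. 2.1]. -/
theorem exists_expLE2_eq {d : Fin 3 →₀ ℕ} (hd : d.degree ≤ 2) : ∃ i, expLE2 i = d := by
  rw [Finsupp.degree_eq_sum, Fin.sum_univ_three] at hd
  have key : ∀ a b c : Fin 3, (a : ℕ) + b + c ≤ 2 → ∃ i, expVec i = ![(a : ℕ), b, c] := by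
    decide
  obtain ⟨i, hi⟩ := key ⟨d 0, by omega⟩ ⟨d 1, by omega⟩ ⟨d 2, by omega⟩ hd
  refine ⟨i, Finsupp.ext fun k => ?_⟩
  rw [expLE2_apply, hi]
  fin_cases k <;> rfl

/-- Real evaluation of a rational polynomial of degree `≤ 2` in three variables through its ten
coefficients (cf. `GramMatrixMethod.support_subset_monomialsLE`)
[cite: Scheiderer2012RationalSOS, Thm. 2.1; Laurent2008, §3.3 Lemma 3.8]. -/
theorem aeval_eq_sum_of_totalDegree_le_two (p : MvPolynomial (Fin 3) ℚ)
    (hp : p.totalDegree ≤ 2) (v : Fin 3 → ℝ) :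
    aeval v p = ∑ i, ((coeff (expLE2 i) p : ℚ) : ℝ) * ∏ k, v k ^ expVec i k := by
  classical
  have hsupp : p.support ⊆ Finset.univ.image expLE2 := by
    intro d hd
    obtain ⟨i, hi⟩ := exists_expLE2_eq (d := d)
      (GramMatrixMethod.mem_monomialsLE.mp (GramMatrixMethod.support_subset_monomialsLE hp hd))
    exact Finset.mem_image.mpr ⟨i, Finset.mem_univ _, hi⟩
  conv_lhs => rw [p.as_sum, map_sum]
  rw [Finset.sum_subset hsupp fun d _ hd => by
    rw [notMem_support_iff.mp hd, monomial_zero, map_zero]]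
  rw [Finset.sum_image fun i _ j _ h => expLE2_injective h]
  refine Finset.sum_congr rfl fun i _ => ?_
  rw [aeval_monomial, Finsupp.prod_fintype _ _ fun k => pow_zero (v k), eq_ratCast]
  rfl

/-- Real evaluation of a rational polynomial of degree `≤ 2` in three variables as
quadratic form + linear form + constant [cite: Scheiderer2012RationalSOS, Thm. 2.1, Lemma 2.3]. -/
theorem aeval_eq_quad_add_lin_add_const (p : MvPolynomial (Fin 3) ℚ) (hp : p.totalDegree ≤ 2)
    (x y z : ℝ) :
    aeval ![x, y, z] p
      = quadForm (fun j => ((coeff (expLE2 (Sum.inl j)) p : ℚ) : ℝ)) x y z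
        + linForm (fun j => ((![coeff (expLE2 (Sum.inr 0)) p, coeff (expLE2 (Sum.inr 1)) p,
            coeff (expLE2 (Sum.inr 2)) p] : Fin 3 → ℚ) j : ℝ)) x y z
        + ((coeff (expLE2 (Sum.inr 3)) p : ℚ) : ℝ) := by
  rw [aeval_eq_sum_of_totalDegree_le_two p hp, Fintype.sum_sum_type, Fin.sum_univ_six,
    Fin.sum_univ_four]
  simp only [Fin.prod_univ_three, expVec, Sum.elim_inl, Sum.elim_inr, Matrix.cons_val_zero,
    Matrix.cons_val_one, Matrix.cons_val, quadForm, linForm]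
  ring

/-- **[cite: Scheiderer2012RationalSOS, Thm. 2.1 (3), Example 2.8] verbatim.**  Scheiderer's quartic,
which has rational coefficients and is a sum of squares in `ℝ[x₀, x₁, x₂]`
(`isSumSq_quartic_real`), is *not* a sum of squares in `ℚ[x₀, x₁, x₂]`: Sturmfels' question has a
negative answer.  Proof: an SOS representation uses polynomials `u_j` of degree `≤ 2`
(`GramMatrixMethod.exists_sum_mul_self_eq_of_isSumSq_of_totalDegree_le`); each `u_j` vanishes on
the real zero lines `ℝ P₊`, `ℝ P₋` of `f`, so its quadratic, linear and constant parts vanish at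
`P₊` and `P₋`; by `quadCoeff_eq_zero` / `linCoeff_eq_zero` (rational coefficients!) every `u_j` is
zero, whence `f = 0`, contradicting `f(1, 0, 0) = 1`. -/
theorem not_isSumSq_quartic_rat : ¬ IsSumSq (quartic ℚ) := by
  intro hsos
  obtain ⟨m, u, hu, hdeg⟩ :=
    GramMatrixMethod.exists_sum_mul_self_eq_of_isSumSq_of_totalDegree_le hsos (d := 2)
      (by simpa using totalDegree_quartic_le ℚ)
  obtain ⟨s, hs, hs1⟩ := exists_s
  -- (i) each `u j` vanishes at every real zero of `f`
  have hvan : ∀ v : Fin 3 → ℝ, F (v 0) (v 1) (v 2) = 0 → ∀ j, aeval v (u j) = 0 := by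
    intro v hv j
    have h := congr_arg (aeval v) hu
    rw [aeval_quartic, hv, map_sum] at h
    simp only [map_mul] at h
    exact mul_self_eq_zero.mp ((Finset.sum_eq_zero_iff_of_nonneg fun i _ =>
      mul_self_nonneg _).mp h.symm j (Finset.mem_univ _))
  -- (ii) hence every `u j` vanishes identically on `ℝ³`
  have hzero : ∀ j (v : Fin 3 → ℝ), aeval v (u j) = 0 := by
    intro j v
    set p := u j with hp_def
    set cq : Fin 6 → ℚ := fun i => coeff (expLE2 (Sum.inl i)) p with hcq
    set cl : Fin 3 → ℚ := ![coeff (expLE2 (Sum.inr 0)) p, coeff (expLE2 (Sum.inr 1)) p,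
      coeff (expLE2 (Sum.inr 2)) p] with hcl
    set c0 : ℚ := coeff (expLE2 (Sum.inr 3)) p with hc0
    have hexp : ∀ x y z : ℝ, aeval ![x, y, z] p = quadForm (fun i => (cq i : ℝ)) x y z
        + linForm (fun i => (cl i : ℝ)) x y z + c0 :=
      aeval_eq_quad_add_lin_add_const p (hdeg j)
    -- vanishing on the lines through the two real zeros splits by homogeneity
    have hline : ∀ a b c : ℝ, (∀ t : ℝ, F (t * a) (t * b) (t * c) = 0) →
        quadForm (fun i => (cq i : ℝ)) a b c = 0 ∧ linForm (fun i => (cl i : ℝ)) a b c = 0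
          ∧ (c0 : ℝ) = 0 := by
      intro a b c habc
      have e : ∀ t : ℝ, t ^ 2 * quadForm (fun i => (cq i : ℝ)) a b c
          + t * linForm (fun i => (cl i : ℝ)) a b c + c0 = 0 := by
        intro t
        have h0 := hvan ![t * a, t * b, t * c] (by simpa using habc t) j
        rw [hexp] at h0
        unfold quadForm linForm at h0 ⊢
        linear_combination h0
      have e1 := e 1
      have e2 := e (-1)
      have e3 := e 2
      norm_num at e1 e2 e3
      refine ⟨by linarith, by linarith, by linarith⟩
    obtain ⟨qP, lP, hc0'⟩ := hline _ _ _ (F_rootPos hs)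
    obtain ⟨qM, lM, -⟩ := hline _ _ _ (F_rootNeg hs)
    have hcq0 : cq = 0 := quadCoeff_eq_zero hs hs1 cq qP qM
    have hcl0 : cl = 0 := linCoeff_eq_zero hs hs1 cl lP lM
    have hc00 : c0 = 0 := by exact_mod_cast hc0'
    have h0 : aeval ![v 0, v 1, v 2] p = 0 := by
      rw [hexp, hcq0, hcl0, hc00]; simp [quadForm, linForm]
    have hv : v = ![v 0, v 1, v 2] := by ext k; fin_cases k <;> rfl
    rw [hv]; exact h0
  -- (iii) so `f` vanishes identically on `ℝ³`, contradicting `f(1, 0, 0) = 1`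
  have h := congr_arg (aeval ![(1 : ℝ), 0, 0]) hu
  rw [aeval_quartic, map_sum] at h
  simp only [map_mul, hzero, mul_zero, Finset.sum_const_zero] at h
  simp [F] at h

end Literature.Algebra.Polynomial.ScheidererTernaryQuartic
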